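import Summits.CriticalPhenomena.PercolationContinuityZ3.Theorems.Transplant.WedgeUniquenessStations
import HarnessLib

/-!
# The all-arms chain in a wedge `W_m` (`d ≥ 3`, `m ≥ 1`): every link satisfies the four `LinkOK` inequalities

builds on p205010 (kernel theorem, internal audit signed; external expert review pending) — nothing in this file uses p205010.
Lane `prim-bschramm`, seat `prim-bschramm-p2` gen 18 (class C1b); helper file (`--supports stmt-CriticalPhenomena-4575 --as helper`) for the
WEDGE UNIQUENESS programme; continues `WedgeUniquenessStations` (constants `J, H0, D0, T0, Bc, L, Hn, Tn, Cn`, `apexW`, `stationW`).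
* **`linkOKW_zero`** — link 0 (apex → `stationW 0`, plane `(x₀, plane0W c)`, sign `sign0W`, port height `H₀`, top `T₀`);
* **`linkOKW_succ`** — link `n+1 < d` (`stationW n → stationW (n+1)`, plane `(x₀, x_{n+1})`, sign `+1`): the three regimes `n+1 = 1` (the big
  height gain `L`), `n+1 = 2` (the wedge coordinate, small canonical value `C₂ = 2N + 12k + 12`, target `0`), `n+1 ≥ 3` (gen 17's constants).
With gen 17's generic `link_prob` / `link_move` (`OrthantUniquenessLink/…LinkMove`) these give the arm events and the moves of the wedge chain.
[cite: AizenmanChayesChayesFrohlichRusso1983, §4 Lemma 4.3 and Cor.] [cite: BarskyGrimmettNewman1991, Comment 6 p. 116]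
-/

noncomputable section

namespace Summit.CriticalPhenomena.PercolationContinuityZ3.Theorems.Transplant

namespace WedgeUniq

open MeasureTheory Literature.Probability.Percolation Literature.Probability.LatticeModels SimpleGraph HSU OrthantUniq
open scoped Classical

variable {d : ℕ} [NeZero d]

section Links

variable (hd : 3 ≤ d) {N : ℕ} (k : ℕ) {F : Face d} {m : ℕ}

/-! ## §3 The link inequalities hold -/

/-- **Link 0 satisfies the link inequalities.** [folklore] -/
theorem linkOKW_zero (hm : 1 ≤ m) (hF : FaceOKW m N F) :
    LinkOK k (apexW N k F) (plane0W hd F.c) (sign0W F) (H0 N k) (c0W hd N k F) (T0 N k) (t0W hd N k F) := by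
  obtain ⟨-, -, -, -, -, -, -, h0J, h0N, -, -⟩ := apexW_facts hd k hm hF
  have hs := sign0W_cases F hF.1
  have hss : sign0W F * sign0W F = 1 := by rcases hs with h | h <;> rw [h] <;> norm_num
  have e1 : sign0W F * (c0W hd N k F - apexW N k F (plane0W hd F.c)) = D0 N k := by
    rw [c0W, show apexW N k F (plane0W hd F.c) + sign0W F * (D0 N k : ℤ) - apexW N k F (plane0W hd F.c) = sign0W F * D0 N k by ring,
      ← mul_assoc, hss, one_mul]
  have e2 : sign0W F * t0W hd N k F = sign0W F * apexW N k F (plane0W hd F.c) - k := by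
    rw [t0W, mul_sub, ← mul_assoc, hss, one_mul]
  have e3 : sign0W F * (c0W hd N k F - t0W hd N k F) = D0 N k + k := by
    rw [mul_sub, e2, c0W, mul_add, ← mul_assoc, hss, one_mul]; ring
  have hJ : (J k : ℤ) = 8 * k + 8 := by simp [J]
  have hH0 : (H0 N k : ℤ) = N + 2 * k + 2 + J k := by simp [H0]
  have hD0 : (D0 N k : ℤ) = H0 N k + 3 * k + 1 := by simp [D0]
  have hT0 : (T0 N k : ℤ) = 2 * H0 N k + 4 * k + 1 := by simp [T0]
  refine ⟨(plane0W_ne hd F).1, hs, by omega, ?_, by rw [e2]; omega, ?_⟩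
  · rw [e1]; omega
  · rw [e3]; omega

/-- **Link `n+1` satisfies the link inequalities** (`n + 1 < d`; the cases `n+1 = 1`, `n+1 = 2`, `n+1 ≥ 3`). [folklore] -/
theorem linkOKW_succ (hm : 1 ≤ m) (hF : FaceOKW m N F) {n : ℕ} (h : n + 1 < d) :
    LinkOK k (stationW hd N k F n) ⟨n + 1, h⟩ 1 (Hn N k (n + 1)) (Cn N k (n + 1)) (Tn N k (n + 1)) (tco N k ⟨n + 1, h⟩) := by
  obtain ⟨h0, hrest, -, h2a, -, -⟩ := stationW_facts hd k hm hF (show n < d by omega)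
  obtain ⟨-, -, -, h02, habs0⟩ := stationW_zero_facts hd k hm hF
  obtain ⟨-, -, -, -, -, h2k, h2N, -, -, -, -⟩ := apexW_facts hd k hm hF
  have hj0 : (⟨n + 1, h⟩ : Fin d) ≠ 0 := by simp [Fin.ext_iff]
  have hbi : stationW hd N k F n ⟨n + 1, h⟩ = stationW hd N k F 0 ⟨n + 1, h⟩ := hrest _ hj0 (by simp)
  have hB := habs0 ⟨n + 1, h⟩ hj0; rw [abs_le] at hB
  obtain ⟨hJ, hH0, hD0, hT0, hBc, hL, hHn0, hHn1, hHn2, hT1, hT2, hC1, hC2⟩ := constants_eqs N k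
  refine ⟨hj0, Or.inl rfl, ?_, ?_, ?_, ?_⟩
  · -- port above apex
    rw [h0]
    rcases Nat.lt_or_ge n 1 with hn | hn
    · have hn0 : n = 0 := by omega
      have e1 : Hn N k (n + 1) = H0 N k + L N k := by subst hn0; exact hHn1
      have e0 : Hn N k n = H0 N k := by subst hn0; exact hHn0
      push_cast [e0, e1, hL]; omega
    · have := (constants_ge N k n).2.1 hn; push_cast [this]; omega
  · -- port beyond the steep reach
    rw [h0, hbi, one_mul]
    rcases Nat.lt_or_ge n 1 with hn | hn
    · have hn0 : n = 0 := by omega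
      have e0 : Hn N k n = H0 N k := by subst hn0; exact hHn0
      have eT : Tn N k (n + 1) = H0 N k + 2 * L N k + 2 * Bc N k + 4 * k + 2 := by subst hn0; exact hT1
      have eC : Cn N k (n + 1) = 2 * Bc N k + L N k + 4 * k + 2 := by subst hn0; exact hC1
      push_cast [e0, eT, eC]; omega
    · rcases Nat.lt_or_ge n 2 with hn' | hn'
      · have hn1 : n = 1 := by omega
        have e2 : (⟨n + 1, h⟩ : Fin d) = 2 := Fin.ext (by rw [fin_two_val hd]; simp; omega)
        rw [e2, h02]
        have e0 : Hn N k n = H0 N k + L N k := by subst hn1; exact hHn1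
        have eT : Tn N k (n + 1) = Hn N k 1 + N + 9 * k + 8 := by subst hn1; exact hT2
        have eC : Cn N k (n + 1) = 2 * N + 12 * k + 12 := by subst hn1; exact hC2
        push_cast [e0, eT, eC, hHn1]; omega
      · obtain ⟨hT, hC⟩ := (constants_ge N k (n + 1)).1 (by omega)
        have hH := (constants_ge N k n).2.1 (by omega)
        push_cast [hT, hC, hH]
        have : (0 : ℤ) ≤ Hn N k n := by positivity
        omega
  · -- target beyond the steep near side
    rw [one_mul, one_mul, hbi, tco]
    split_ifs with h2
    · have hn1 : n = 1 := by simp at h2; omega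
      have e2 : (⟨n + 1, h⟩ : Fin d) = 2 := Fin.ext (by rw [fin_two_val hd]; simp; omega)
      rw [e2, h02]; omega
    · omega
  · -- top above the shallow reach
    rw [one_mul, tco]
    rcases Nat.lt_or_ge n 1 with hn | hn
    · have hn0 : n = 0 := by omega
      rw [if_neg (by simp; omega)]
      have e1 : Hn N k (n + 1) = H0 N k + L N k := by subst hn0; exact hHn1
      have eT : Tn N k (n + 1) = H0 N k + 2 * L N k + 2 * Bc N k + 4 * k + 2 := by subst hn0; exact hT1
      have eC : Cn N k (n + 1) = 2 * Bc N k + L N k + 4 * k + 2 := by subst hn0; exact hC1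
      push_cast [e1, eT, eC]; omega
    · rcases Nat.lt_or_ge n 2 with hn' | hn'
      · have hn1 : n = 1 := by omega
        rw [if_pos (by simp; omega)]
        have e1 : Hn N k (n + 1) = H0 N k + L N k + (k + 1) := by subst hn1; exact hHn2
        have eT : Tn N k (n + 1) = Hn N k 1 + N + 9 * k + 8 := by subst hn1; exact hT2
        have eC : Cn N k (n + 1) = 2 * N + 12 * k + 12 := by subst hn1; exact hC2
        push_cast [e1, eT, eC, hHn1]; omega
      · rw [if_neg (by simp; omega)]
        obtain ⟨hT, hC⟩ := (constants_ge N k (n + 1)).1 (by omega)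
        push_cast [hT, hC]; omega

end Links

end WedgeUniq

end Summit.CriticalPhenomena.PercolationContinuityZ3.Theorems.Transplant

end
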